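import Summits.BirchSwinnertonDyer.BirchSwinnertonDyer.Theorems.PrintCFramTCubeNoNineTorsion
import HarnessLib

/-!
# Route PrintCFram, regime T: the global defect `d₀ = #W(K)[3^∞]` of the T package AS A NUMBER,
# class-wide — `3` on cube-sum frames, `1` on all others (cell `bsd-print-cfram`, seat p4 g3;
# supports stmt-BirchSwinnertonDyer-20699)

HONEST FRAMING (cell `bsd-print-cfram`, run/shared/lean/pub/bsd-print-cfram/, D-0131 (2) print
tier; verbatim in every file of the seat): the cell works the partition leaf
`CornerF ∧ p ramified in the CM field K` (LADDER-BSD row K7r = B13; W-ALL row 12r) in PARTITION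
currency — a leaf or a cell counts only when its theorem is in the kernel BY NAME. Nothing is
closed here. CAPSTONE of the seat's `d₀` files (p558062 `…GlobalDefect`, p559950 `…GlobalDefectThree`,
`…NoNineTorsion`): for a `3`-frame field (`[K:ℚ] = 2`, `d_K = −3`) and ANY model `W` over `ℚ` of
`y² = x³ + k` (`C • W = E_k`, `k ≠ 0`; `4k ∉ ℚ³` is used only in the `= 3` case, where it is
automatic on the leaf: a cube-sum-type sixth-power-free `k` with `4k ∈ ℚ³` is `16` or `−432`, the
rank-`0` class 27a), the `3`-primary part of `W(K)` has
**`Nat.card = 3` if `k ∈ ℚ² ∨ −3k ∈ ℚ²` (T_cube) and `Nat.card = 1` otherwise (N, V, T_split)**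
(`card_threePrimary_frameField_eq_three / _eq_one`) — ty3 PART H's column `d0` (kit j287122 ‖
j287127: `3` on 178/178 T_cube classes, `1` on 296/296 T_split) and ty2's displayed global defect of
the T package, as ONE kernel theorem for every `j = 0` class. Theorems only; no named fact.
beyond-print: NO.

References: `Theorems/PrintCFramTCubeGlobalDefect{,Three}.lean`, `Theorems/PrintCFramTCubeNoNineTorsion.lean`;
ty3 `X12/CMRamifiedRecordSchemaH.lean`; [cite: SilvermanAEC2009, Exercise 3.7 and III.10].
-/

set_option linter.dupNamespace false
set_option autoImplicit false

noncomputable section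

open scoped Classical
open WeierstrassCurve Literature.NumberTheory.EllipticCurves
  Literature.NumberTheory.EllipticCurves.Rank1Residual
  Summit.BirchSwinnertonDyer.Rank1Residual Summit.BirchSwinnertonDyer.Rank1Residual.X12

namespace Summit.BirchSwinnertonDyer.BirchSwinnertonDyer.Theorems.PrintCFram.GlobalDefect

/-! ## §3 The number `d₀ = #W(K)[3^∞]` itself -/

section Card

variable {K : Type} [Field K] [NumberField K]

/-- `3ⁿ`-torsion is `3`-torsion on a `3`-frame (`4k ∉ ℚ³`): iterate `nine_torsion_frameField`.
[cite: SilvermanAEC2009, Exercise 3.7 and III.10] -/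
theorem threePow_torsion_frameField (hK2 : Module.finrank ℚ K = 2) (hdK : NumberField.discr K = -3)
    {W : WeierstrassCurve ℚ} {C : VariableChange ℚ} {k : ℚ} (hk : k ≠ 0)
    (hW : C • W = mordellCurve k) (hcube : ¬ ∃ c : ℚ, c ^ 3 = 4 * k) :
    ∀ (n : ℕ) (Q : (W.baseChange K).toAffine.Point), (3 : ℕ) ^ (n + 1) • Q = 0 → (3 : ℕ) • Q = 0 := by
  intro n
  induction n with
  | zero => intro Q hQ; simpa using hQ
  | succ n ih =>
    intro Q hQ
    -- `3^(n+2) • Q = 9 • (3^n • Q)`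
    have e1 : (9 : ℕ) • ((3 : ℕ) ^ n • Q) = (3 : ℕ) ^ (n + 1 + 1) • Q := by
      rw [← mul_nsmul']; congr 1; ring
    have h9 : (9 : ℕ) • ((3 : ℕ) ^ n • Q) = 0 := by rw [e1]; exact hQ
    have h3 : (3 : ℕ) • ((3 : ℕ) ^ n • Q) = 0 := nine_torsion_frameField hK2 hdK hk hW hcube _ h9
    refine ih Q ?_
    have e2 : (3 : ℕ) ^ (n + 1) • Q = (3 : ℕ) • ((3 : ℕ) ^ n • Q) := by
      rw [← mul_nsmul']; congr 1; ring
    rw [e2]; exact h3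

/-- **`d₀ = 1` off T_cube.** `[K:ℚ] = 2`, `d_K = −3`, `C • W = E_k` (`k ≠ 0`), `k ∉ ℚ²`, `−3k ∉ ℚ²`:
the `3`-primary part of `W(K)` is trivial, `#W(K)[3^∞] = 1` (regimes N, V, T_split).
[cite: SilvermanAEC2009, Exercise 3.7] -/
theorem card_threePrimary_frameField_eq_one (hK2 : Module.finrank ℚ K = 2)
    (hdK : NumberField.discr K = -3) {W : WeierstrassCurve ℚ} {C : VariableChange ℚ} {k : ℚ}
    (hk : k ≠ 0) (hW : C • W = mordellCurve k) (h : ¬ (IsSquare k ∨ IsSquare (-3 * k))) :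
    Nat.card (AddCommGroup.primaryComponent (W.baseChange K).toAffine.Point 3) = 1 := by
  have hall := (threeTorsion_frameField_iff hK2 hdK hk hW).2 h
  have hbot : ∀ x ∈ AddCommGroup.primaryComponent (W.baseChange K).toAffine.Point 3, x = 0 := by
    intro x hx
    obtain ⟨n, hn⟩ := (AddCommGroup.mem_primaryComponent).mp hx
    exact hall n x hn
  haveI : Subsingleton ↥(AddCommGroup.primaryComponent (W.baseChange K).toAffine.Point 3) :=
    ⟨fun a b ↦ Subtype.ext ((hbot a.1 a.2).trans (hbot b.1 b.2).symm)⟩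
  exact Nat.card_of_subsingleton (0 : ↥(AddCommGroup.primaryComponent (W.baseChange K).toAffine.Point 3))

/-- **`d₀ = 3` on T_cube.** `[K:ℚ] = 2`, `d_K = −3`, `C • W = E_k` (`k ≠ 0`, `4k ∉ ℚ³`), `k ∈ ℚ²` or
`−3k ∈ ℚ²`: the `3`-primary part of `W(K)` is `{O, T, −T}` for a point `T` of order `3` —
`#W(K)[3^∞] = 3` EXACTLY, on both members of every T_cube frame of the leaf (ty3 PART H: 178/178).
[cite: SilvermanAEC2009, Exercise 3.7 and III.10] -/
theorem card_threePrimary_frameField_eq_three (hK2 : Module.finrank ℚ K = 2)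
    (hdK : NumberField.discr K = -3) {W : WeierstrassCurve ℚ} {C : VariableChange ℚ} {k : ℚ}
    (hk : k ≠ 0) (hW : C • W = mordellCurve k) (hcube : ¬ ∃ c : ℚ, c ^ 3 = 4 * k)
    (h : IsSquare k ∨ IsSquare (-3 * k)) :
    Nat.card (AddCommGroup.primaryComponent (W.baseChange K).toAffine.Point 3) = 3 := by
  set G := (W.baseChange K).toAffine.Point
  set S := AddCommGroup.primaryComponent G 3 with hS
  -- a non-zero `3`-torsion point `T`
  have hex : ¬ ∀ Q : G, (3 : ℕ) • Q = 0 → Q = 0 := by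
    rw [(threeTorsion_frameField_iff hK2 hdK hk hW).1]; exact fun hn => hn h
  push Not at hex
  obtain ⟨T, hT3, hT0⟩ := hex
  have hTneg : T ≠ -T := by
    intro hTT
    apply hT0
    have h2 : (2 : ℕ) • T = 0 := by rw [two_nsmul]; nth_rw 2 [hTT]; exact add_neg_cancel T
    have h32 : (3 : ℕ) • T = (2 : ℕ) • T + T := succ_nsmul T 2
    rw [hT3, h2, zero_add] at h32
    exact h32.symm
  have hneg0 : -T ≠ 0 := fun h0 => hT0 (neg_eq_zero.mp h0)
  -- membership: `S = {0, T, −T}`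
  have hmem3 : ∀ {Q : G}, (3 : ℕ) • Q = 0 → Q ∈ S := fun {Q} hQ =>
    (AddCommGroup.mem_primaryComponent).mpr ⟨1, by simpa using hQ⟩
  have hset : (S : Set G) = {0, T, -T} := by
    ext Q
    simp only [SetLike.mem_coe, Set.mem_insert_iff, Set.mem_singleton_iff]
    constructor
    · intro hQ
      obtain ⟨n, hn⟩ := (AddCommGroup.mem_primaryComponent).mp hQ
      have hQ3 : (3 : ℕ) • Q = 0 := by
        cases n with
        | zero => simp only [pow_zero, one_smul] at hn; rw [hn]; exact nsmul_zero _
        | succ n => exact threePow_torsion_frameField hK2 hdK hk hW hcube n Q hn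
      by_cases hQ0 : Q = 0
      · exact Or.inl hQ0
      · exact Or.inr (threeTorsion_frameField_eq_or_eq_neg hK2 hdK hW hcube hQ3 hT3 hQ0 hT0)
    · rintro (rfl | rfl | rfl)
      · exact zero_mem S
      · exact hmem3 hT3
      · exact hmem3 (by rw [neg_nsmul, hT3, neg_zero])
  have hcard : Nat.card ↥S = (S : Set G).ncard := (Nat.card_coe_set_eq (S : Set G)).symm
  rw [hcard, hset, Set.ncard_eq_three]
  exact ⟨0, T, -T, hT0.symm, hneg0.symm, hTneg, rfl⟩

end Card

/-! ## §4 Discharging `4k ∉ ℚ³` per class -/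

section Cube

/-- **A rational cube has all its `p`-adic valuations divisible by `3`**: if `3 ∤ v_p(m)` for some
prime `p` (`m ∈ ℤ`; for `m = 0` the hypothesis is void), then `m` is not the cube of a rational number. Per class this discharges the
hypothesis `4k ∉ ℚ³` of the `d₀` theorems by `decide` on one displayed prime. [folklore] -/
theorem not_exists_rat_cube_of_padicValInt (p : ℕ) [Fact p.Prime] {m : ℤ}
    (h : ¬ (3 : ℤ) ∣ (padicValInt p m : ℤ)) : ¬ ∃ c : ℚ, c ^ 3 = (m : ℚ) := by
  rintro ⟨c, hc⟩
  have hv : padicValRat p (c ^ 3) = padicValRat p (m : ℚ) := by rw [hc]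
  rw [padicValRat.pow c, padicValRat.of_int] at hv
  exact h ⟨padicValRat p c, by rw [← hv]; ring⟩

/-- The same with the factor `4` of the `d₀` theorems displayed: `3 ∤ v_p(4k)` for some prime `p`
gives `¬ ∃ c : ℚ, c³ = 4k`. [folklore] -/
theorem not_exists_rat_cube_four_mul (p : ℕ) [Fact p.Prime] {k : ℤ}
    (h : ¬ (3 : ℤ) ∣ (padicValInt p (4 * k) : ℤ)) : ¬ ∃ c : ℚ, c ^ 3 = 4 * ((k : ℤ) : ℚ) := by
  have := not_exists_rat_cube_of_padicValInt p h
  push_cast at this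
  exact this

/-- **Decidable form**: `pᵃ ∣ m`, `pᵃ⁺¹ ∤ m`, `3 ∤ a` ⟹ `m ∉ ℚ³` (the exponent `a = v_p(m)` displayed,
so that per class the three hypotheses are `decide`). [folklore] -/
theorem not_exists_rat_cube_of_pow_dvd (p : ℕ) [Fact p.Prime] {m : ℤ} {a : ℕ}
    (ha : (p : ℤ) ^ a ∣ m) (ha' : ¬ (p : ℤ) ^ (a + 1) ∣ m) (h3 : ¬ 3 ∣ a) :
    ¬ ∃ c : ℚ, c ^ 3 = (m : ℚ) := by
  have hm : m ≠ 0 := by rintro rfl; exact ha' (dvd_zero _)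
  have hv : padicValInt p m = a := by
    apply le_antisymm
    · by_contra hlt
      push Not at hlt
      exact ha' (dvd_trans (pow_dvd_pow (p : ℤ) (by omega)) (padicValInt_dvd m))
    · rcases (padicValInt_dvd_iff (p := p) a m).mp ha with h | h
      · exact absurd h hm
      · exact h
  refine not_exists_rat_cube_of_padicValInt p (m := m) ?_
  rw [hv]
  exact_mod_cast h3

end Cube

end Summit.BirchSwinnertonDyer.BirchSwinnertonDyer.Theorems.PrintCFram.GlobalDefect

end
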